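import Summits.Ventures.PercRepro.MSTightCompletionRowA

/-!
# The fibre of the partnerless row: full rows, maximality, and the lost sets within `M`

Dossier proofs/MINE1-theoremS.md, Addendum 57 §2, suppl. 1–4 and suppl. 8; HANDOFF §mine-1
gen 32 → 33, step (K4b). Setting as in `MSTightCompletionRowA.lean` (shape A, genuine, twin-free,
some `r`-member without `r`-free partner), `s` a partnerless `r`-free member with row `x* = s ∖ M`.

* every fibre of `Y` lies in `M − U₀` (`fibre_diffsY_subset_complWithin`);
* every row `x ≠ x*` is FULL: `x ∪ y ∈ K` for all `y ∈ U₀` (`union_mem_partner_of_ne`,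
  from (ROW-a));
* a row below a full row has the whole of `M − U₀` as fibre
  (`complWithin_subset_fibre_of_subset`); so if some column `z ∈ M − U₀` is missing from the
  fibre of `x*`, the row `x*` is MAXIMAL in `L` (`maximal_of_notMem_fibre`);
* for a maximal row the fibre is exactly `(M − U₀) ∩ ↓((U ∖ U₀) ∪ K^x)`
  (`fibre_diffsY_eq_filter_of_maximal`), i.e. `M − U₀` minus the LOST sets
  `lostWithin M U U₀ K^x = {z ∈ M − U₀ : every g ∈ U above z lies in U₀ ∖ K^x}`
  (`fibre_diffsY_eq_sdiff_lostWithin_of_maximal`), and the excess one of the row `x*` becomes the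
  EXACT-EXCESS count `|U₀ ∖ K^{x*}| = |Lost| + 1` (`card_sdiff_eq_card_lostWithin_add_one`) —
  the hypothesis of (MIN) in Addendum 57 suppl. 8 / Addendum 58.
-/

namespace PercRepro.MSTight

open Finset
open scoped FinsetFamily

variable {α : Type*} [DecidableEq α]

section LostWithin

/-- The lost sets within `M`: the members of `M − U₀` no member of `(U ∖ U₀) ∪ T` lies above. -/
def lostWithin (M : Finset α) (U U₀ T : Finset (Finset α)) : Finset (Finset α) :=
  (complWithin M U₀).filter fun z => ∀ g ∈ U, z ⊆ g → g ∈ U₀ \ T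

/-- Membership in the lost sets within `M`. -/
theorem mem_lostWithin {M z : Finset α} {U U₀ T : Finset (Finset α)} :
    z ∈ lostWithin M U U₀ T ↔ z ∈ complWithin M U₀ ∧ ∀ g ∈ U, z ⊆ g → g ∈ U₀ \ T := by
  simp only [lostWithin, mem_filter]

/-- The lost sets lie in `M − U₀`. -/
theorem lostWithin_subset {M : Finset α} {U U₀ T : Finset (Finset α)} :
    lostWithin M U U₀ T ⊆ complWithin M U₀ := filter_subset _ _

/-- The members of `M − U₀` below some member of `(U ∖ U₀) ∪ T` are the non-lost ones. -/
theorem filter_below_eq_sdiff_lostWithin {M : Finset α} {U U₀ T : Finset (Finset α)}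
    (hU₀U : U₀ ⊆ U) (hT : T ⊆ U₀) :
    (complWithin M U₀).filter (fun z => ∃ g ∈ (U \ U₀) ∪ T, z ⊆ g) =
      complWithin M U₀ \ lostWithin M U U₀ T := by
  ext z
  rw [mem_filter, mem_sdiff, mem_lostWithin]
  constructor
  · rintro ⟨hz, g, hg, hzg⟩
    refine ⟨hz, fun h => ?_⟩
    have := h.2 g ?_ hzg
    · rcases mem_union.1 hg with hg | hg
      · exact (mem_sdiff.1 hg).2 (mem_sdiff.1 this).1
      · exact (mem_sdiff.1 this).2 hg
    · rcases mem_union.1 hg with hg | hg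
      · exact (mem_sdiff.1 hg).1
      · exact hU₀U (hT hg)
  · rintro ⟨hz, h⟩
    refine ⟨hz, ?_⟩
    by_contra hcon
    apply h
    refine ⟨hz, fun g hg hzg => ?_⟩
    by_contra hg'
    apply hcon
    refine ⟨g, ?_, hzg⟩
    rw [mem_sdiff] at hg'
    rw [mem_union, mem_sdiff]
    by_cases hg0 : g ∈ U₀
    · exact Or.inr (by_contra fun hT' => hg' ⟨hg0, hT'⟩)
    · exact Or.inl ⟨hg, hg0⟩

end LostWithin

section RowsB

variable [Fintype α] {F : Finset (Finset α)} {r : α}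

/-- **Every fibre of `Y` lies in `M − U₀`.** -/
theorem fibre_diffsY_subset_complWithin (htw : ∀ a b, Twin F a b → a = b)
    (hcore : ∀ a, ∃ t ∈ F, a ∉ t) (hC : Tight (completion0 r F)) (x : Finset α) :
    fibre (cM r F) (diffsY r F) x ⊆ complWithin (cM r F) (cU0 r F) := by
  intro z hz
  obtain ⟨hzM, hz⟩ := mem_fibre.1 hz
  obtain ⟨t, ht, s, hs, hts⟩ := mem_diffs.1 hz
  have hys : s ∩ cM r F ∈ cU0 r F := inter_cM_mem_cU0_of_mem_part0 htw hcore hC hs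
  refine mem_complWithin.2 ⟨cM r F \ z, ?_, Finset.sdiff_sdiff_eq_self hzM⟩
  refine isUpSetWithin_cU0 htw hcore hC _ hys _ sdiff_subset fun a ha => ?_
  obtain ⟨has, haM⟩ := mem_inter.1 ha
  refine mem_sdiff.2 ⟨haM, fun haz => ?_⟩
  have : a ∈ t \ s := by
    rw [hts]
    exact mem_union_right _ haz
  exact (mem_sdiff.1 this).2 has

/-- **Every row other than the partnerless row is full**: `x ∪ y ∈ K` for `x ∈ L`, `x ≠ x*`,
`y ∈ U₀`. -/
theorem union_mem_partner_of_ne (htw : ∀ a b, Twin F a b → a = b)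
    (hF : (F \\ F).card = F.card + 1) (hE : (∅ : Finset α) ∉ F) (hU : (univ : Finset α) ∉ F)
    (hcore : ∀ a, ∃ t ∈ F, a ∉ t) (hsupp : ∀ a, ∃ t ∈ F, a ∈ t) (hP : Tight (proj r F))
    (hC : Tight (completion0 r F)) (hU₁ : ¬ partr r F ⊆ part0 r F) {s : Finset α}
    (hs : s ∈ part0 r F) (hsK : s ∉ partner r F) {x y : Finset α} (hx : x ∈ cL r F)
    (hxs : x ≠ s \ cM r F) (hy : y ∈ cU0 r F) : x ∪ y ∈ partner r F := by
  by_contra h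
  have h0 : x ∪ y ∈ part0 r F := union_mem_part0 htw hcore hC hx hy
  have := sdiff_cM_eq_of_notMem_partner htw hF hE hU hcore hsupp hP hC hU₁ h0 h hs hsK
  rw [union_sdiff_cM_eq hx (subset_cM_of_mem_cU0 hy)] at this
  exact hxs this

/-- **A row below a full row has the whole of `M − U₀` as fibre.** -/
theorem complWithin_subset_fibre_of_subset (htw : ∀ a b, Twin F a b → a = b)
    (hF : (F \\ F).card = F.card + 1) (hE : (∅ : Finset α) ∉ F) (hU : (univ : Finset α) ∉ F)
    (hcore : ∀ a, ∃ t ∈ F, a ∉ t) (hsupp : ∀ a, ∃ t ∈ F, a ∈ t) (hC : Tight (completion0 r F))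
    {x x' : Finset α} (hx' : x' ∈ cL r F) (hxx' : x ⊆ x') (hM : x' ∪ cM r F ∈ partner r F) :
    complWithin (cM r F) (cU0 r F) ⊆ fibre (cM r F) (diffsY r F) x := by
  intro z hz
  obtain ⟨y, hy, rfl⟩ := mem_complWithin.1 hz
  have hyM := subset_cM_of_mem_cU0 hy
  have hs : y ∈ part0 r F := by
    have := union_mem_part0 htw hcore hC (empty_mem_cL hcore) hy
    rwa [empty_union] at this
  have hY : x' ∪ (cM r F \ y) ∈ diffsY r F := by
    refine mem_diffs.2 ⟨x' ∪ cM r F, inter_subset_right hM, y, hs, ?_⟩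
    exact union_sdiff_eq_union_sdiff (disjoint_cM_of_mem_cL hx') hyM (Subset.refl _) sdiff_subset
  exact mem_fibre.2 ⟨sdiff_subset, mem_diffsY_of_subset_of_genuine htw hF hE hU hcore hsupp hY
    (union_subset_union hxx' (Subset.refl _))⟩

/-- **A column of `M − U₀` missing from the fibre of the partnerless row makes that row maximal in
`L`.** -/
theorem maximal_of_notMem_fibre (htw : ∀ a b, Twin F a b → a = b)
    (hF : (F \\ F).card = F.card + 1) (hE : (∅ : Finset α) ∉ F) (hU : (univ : Finset α) ∉ F)
    (hcore : ∀ a, ∃ t ∈ F, a ∉ t) (hsupp : ∀ a, ∃ t ∈ F, a ∈ t) (hP : Tight (proj r F))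
    (hC : Tight (completion0 r F)) (hU₁ : ¬ partr r F ⊆ part0 r F) {s : Finset α}
    (hs : s ∈ part0 r F) (hsK : s ∉ partner r F) {z : Finset α}
    (hz : z ∈ complWithin (cM r F) (cU0 r F)) (hzY : z ∉ fibre (cM r F) (diffsY r F) (s \ cM r F)) :
    ∀ x' ∈ cL r F, s \ cM r F ⊆ x' → x' = s \ cM r F := by
  intro x' hx' hsx'
  by_contra hne
  apply hzY
  refine complWithin_subset_fibre_of_subset htw hF hE hU hcore hsupp hC hx' hsx' ?_ hz
  exact union_mem_partner_of_ne htw hF hE hU hcore hsupp hP hC hU₁ hs hsK hx' hne (cM_mem_cU0 hcore)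

/-- **The fibre of a maximal row is exactly `(M − U₀) ∩ ↓((U ∖ U₀) ∪ K^x)`.** -/
theorem fibre_diffsY_eq_filter_of_maximal (htw : ∀ a b, Twin F a b → a = b)
    (hcore : ∀ a, ∃ t ∈ F, a ∉ t) (hC : Tight (completion0 r F)) {x : Finset α} (hx : x ∈ cL r F)
    (hmax : ∀ x' ∈ cL r F, x ⊆ x' → x' = x) :
    fibre (cM r F) (diffsY r F) x = (complWithin (cM r F) (cU0 r F)).filter
      (fun z => ∃ g ∈ cU r F \ cU0 r F ∪ fibre (cM r F) (partner r F) x, z ⊆ g) := by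
  refine Subset.antisymm ?_ (filter_complWithin_subset_fibre htw hcore hC hx)
  intro z hz
  refine mem_filter.2 ⟨fibre_diffsY_subset_complWithin htw hcore hC x hz, ?_⟩
  obtain ⟨hzM, hz'⟩ := mem_fibre.1 hz
  obtain ⟨t, ht, s, hs, hts⟩ := mem_diffs.1 hz'
  have htP : t ∈ proj r F := mem_proj_of_mem_partr ht
  have hxt : x ⊆ t \ cM r F := by
    intro a hax
    have : a ∈ t \ s := by
      rw [hts]
      exact mem_union_left _ hax
    exact mem_sdiff.2 ⟨(mem_sdiff.1 this).1, disjoint_left.1 (disjoint_cM_of_mem_cL hx) hax⟩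
  have hxt' : t \ cM r F = x := hmax _ (sdiff_cM_mem_cL_of_mem_proj htw hcore hC htP) hxt
  have hg : t ∩ cM r F ∈ cU r F := inter_cM_mem_cU_of_mem_proj htw hcore hC htP
  have hzg : z ⊆ t ∩ cM r F := by
    intro a haz
    have : a ∈ t \ s := by
      rw [hts]
      exact mem_union_right _ haz
    exact mem_inter.2 ⟨(mem_sdiff.1 this).1, hzM haz⟩
  refine ⟨t ∩ cM r F, ?_, hzg⟩
  by_cases h0 : t ∩ cM r F ∈ cU0 r F
  · refine mem_union_right _ (mem_fibre.2 ⟨inter_subset_right, ?_⟩)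
    have : t ∈ part0 r F := by
      have := union_mem_part0 htw hcore hC hx h0
      rwa [← hxt', sdiff_union_inter] at this
    rw [← hxt', sdiff_union_inter]
    exact mem_inter.2 ⟨this, ht⟩
  · exact mem_union_left _ (mem_sdiff.2 ⟨hg, h0⟩)

/-- **The fibre of a maximal row is `M − U₀` minus the lost sets.** -/
theorem fibre_diffsY_eq_sdiff_lostWithin_of_maximal (htw : ∀ a b, Twin F a b → a = b)
    (hcore : ∀ a, ∃ t ∈ F, a ∉ t) (hC : Tight (completion0 r F)) {x : Finset α} (hx : x ∈ cL r F)
    (hmax : ∀ x' ∈ cL r F, x ⊆ x' → x' = x) :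
    fibre (cM r F) (diffsY r F) x = complWithin (cM r F) (cU0 r F) \
      lostWithin (cM r F) (cU r F) (cU0 r F) (fibre (cM r F) (partner r F) x) := by
  rw [fibre_diffsY_eq_filter_of_maximal htw hcore hC hx hmax,
    filter_below_eq_sdiff_lostWithin (cU0_subset_cU htw hcore hC)
      (fibre_partner_subset_cU0 htw hcore hC hx)]

/-- A column of `M − U₀` missing from the fibre of a maximal row is lost. -/
theorem mem_lostWithin_of_notMem_fibre (htw : ∀ a b, Twin F a b → a = b)
    (hcore : ∀ a, ∃ t ∈ F, a ∉ t) (hC : Tight (completion0 r F)) {x : Finset α} (hx : x ∈ cL r F)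
    (hmax : ∀ x' ∈ cL r F, x ⊆ x' → x' = x) {z : Finset α}
    (hz : z ∈ complWithin (cM r F) (cU0 r F)) (hzY : z ∉ fibre (cM r F) (diffsY r F) x) :
    z ∈ lostWithin (cM r F) (cU r F) (cU0 r F) (fibre (cM r F) (partner r F) x) := by
  rw [fibre_diffsY_eq_sdiff_lostWithin_of_maximal htw hcore hC hx hmax, mem_sdiff, not_and,
    not_not] at hzY
  exact hzY hz

/-- **The exact-excess count of the partnerless row**, when it is maximal:
`|U₀ ∖ K^{x*}| = |Lost| + 1`. -/
theorem card_sdiff_eq_card_lostWithin_add_one (htw : ∀ a b, Twin F a b → a = b)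
    (hF : (F \\ F).card = F.card + 1) (hE : (∅ : Finset α) ∉ F) (hU : (univ : Finset α) ∉ F)
    (hcore : ∀ a, ∃ t ∈ F, a ∉ t) (hsupp : ∀ a, ∃ t ∈ F, a ∈ t) (hP : Tight (proj r F))
    (hC : Tight (completion0 r F)) (hU₁ : ¬ partr r F ⊆ part0 r F) {s : Finset α}
    (hs : s ∈ part0 r F) (hsK : s ∉ partner r F)
    (hmax : ∀ x' ∈ cL r F, s \ cM r F ⊆ x' → x' = s \ cM r F) :
    (cU0 r F \ fibre (cM r F) (partner r F) (s \ cM r F)).card =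
      (lostWithin (cM r F) (cU r F) (cU0 r F) (fibre (cM r F) (partner r F) (s \ cM r F))).card
        + 1 := by
  have hx : s \ cM r F ∈ cL r F :=
    sdiff_cM_mem_cL_of_mem_proj htw hcore hC (mem_proj_of_mem_part0 hs)
  have h1 := card_fibre_diffsY_eq_add_one htw hF hE hU hcore hsupp hP hC hU₁ hs hsK
  rw [fibre_diffsY_eq_sdiff_lostWithin_of_maximal htw hcore hC hx hmax,
    card_sdiff_of_subset lostWithin_subset,
    card_complWithin (fun _ hy => subset_cM_of_mem_cU0 hy)] at h1
  rw [card_sdiff_of_subset (fibre_partner_subset_cU0 htw hcore hC hx)]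
  have h2 := card_le_card (lostWithin_subset (M := cM r F) (U := cU r F) (U₀ := cU0 r F)
    (T := fibre (cM r F) (partner r F) (s \ cM r F)))
  rw [card_complWithin (fun _ hy => subset_cM_of_mem_cU0 hy)] at h2
  have h3 := card_le_card (fibre_partner_subset_cU0 htw hcore hC hx)
  omega

end RowsB

end PercRepro.MSTight
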